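import Mathlib
import Literature.Computability.AlgebraicComplexity.RealTauKnownCases
import Summits.ValiantsHypothesis.ValiantsHypothesis.Theorems.LacunarySymmetroidMatrixDescartesCensusRealExpKit
import Summits.ValiantsHypothesis.ValiantsHypothesis.Theorems.LacunarySymmetroidDoorA26ExtremalInverseDefs
import Summits.ValiantsHypothesis.ValiantsHypothesis.Theorems.LacunarySymmetroidDoorA26ExtremalInverseStubExtremalInverse
import Summits.ValiantsHypothesis.ValiantsHypothesis.Theorems.LacunarySymmetroidDoorA26ExtremalInverseEquivalence

/-!
# Route `LacunarySymmetroid` — crux `DoorA26` (stmt-ValiantsHypothesis-19979), line «extremal-inverse»: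
# every `K = 6` would-be Gram is INDEFINITE (`n₊ ≥ 1` and `n₋ ≥ 1`) — rung one of the signature law, PROVED

The line's conjectured SIGNATURE LAW `stub_signatureLaw6` (OPEN; the bet) says every `K = 6` would-be Gram `extremalGram E σ r c`
has `n₊ ≥ 2` (and, with `−c`, `n₋ ≥ 2`); the line card records the pattern `min(n₊,n₋) ≥ ⌊(K−2)/2⌋` for `K = 4…7`.  This file
PROVES rung one for every would-be Gram, with no hypothesis beyond the Sidon/sorted/nonzero data:

* `momentCurve_form_eq_eval` — along the moment curve `γ(x) = (x^{dᵢ})` the quadratic form of `M` is `(gramPoly d M)(x)`;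
* `countP_pos_roots_gramPoly_le` — Descartes WITH multiplicity: `gramPoly d M ≠ 0` has at most `20` positive roots counted with
  multiplicity (Mathlib `roots_countP_pos_le_signVariations`, tree `signVariations_lt_card_support`, `≤ 21` monomials);
* `sum_rootMultiplicity_le`, `rootMultiplicity_extremalGram_eq_one` — hence the twenty roots of a would-be Gram's fewnomial
  (`gramPoly_extremalGram_isRoot`, …Equivalence) are all SIMPLE;
* `indefinite_extremalGram` — **every would-be Gram is indefinite**: a simple zero of the fewnomial is a strict sign change
  (`Census.RealExp.exists_sign_change_of_hasDerivAt`, `Polynomial.hasDerivAt`), so two moment vectors have `M`-norms of opposite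
  signs: `(∃ x, 0 < xᵀ M x) ∧ (∃ y, yᵀ M y < 0)`.

HONEST FRAMING.  Rung one (`n₊, n₋ ≥ 1`) is far from the law (`≥ 2`) and from `DoorA26` (a symmetroid Gram `v vᵀ − u uᵀ − w wᵀ` is
typically indefinite too, so this excludes nothing); it is recorded as the proved base of the ladder and as reusable tooling (simple
roots, moment-curve evaluation).  Closes no item (`--supports stmt-ValiantsHypothesis-19979`, helper); `DoorA26` OPEN; nothing on
`MatrixDescartes`, Conjecture B or `VP ≠ VNP`.  Width seat val-width-19979-ei1 (cell valiant-width), 2026-08-28.  [folklore]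
-/

-- `Summit.ValiantsHypothesis.ValiantsHypothesis.…` repeats a component by the D-0017 layout
-- (single-conjunct summit), which the `dupNamespace` linter flags; the name is mandated.
set_option linter.dupNamespace false

namespace Summit.ValiantsHypothesis.ValiantsHypothesis.Theorems.LacunarySymmetroid.DoorA26.ExtremalInverse

open Polynomial Matrix Finset
open scoped BigOperators
open Summit.ValiantsHypothesis.ValiantsHypothesis.Theorems.LacunarySymmetroidMatrixDescartes.Census.RealExp
  (exists_sign_change_of_hasDerivAt)

/-! ### 1. The quadratic form on the moment curve is the fewnomial -/

/-- On the moment curve `γ(x) = (x^{d_0}, …, x^{d_5})` the quadratic form of `M` is the fewnomial `gramPoly d M`: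
`γ(x)ᵀ M γ(x) = (gramPoly d M)(x)`. [folklore] -/
theorem momentCurve_form_eq_eval (d : Fin 6 → ℕ) (M : Matrix (Fin 6) (Fin 6) ℝ) (x : ℝ) :
    (fun i => x ^ d i) ⬝ᵥ M.mulVec (fun i => x ^ d i) = (gramPoly d M).eval x := by
  rw [eval_gramPoly]
  simp only [dotProduct, Matrix.mulVec, Finset.mul_sum]
  refine Finset.sum_congr rfl fun i _ => Finset.sum_congr rfl fun j _ => ?_
  rw [pow_add]
  ring

/-! ### 2. Descartes with multiplicity: the twenty roots of a would-be Gram's fewnomial are simple -/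

/-- Descartes' bound WITH multiplicity for the quadratic-form fewnomial: the positive roots of `gramPoly d M ≠ 0`, counted with
multiplicity, number at most `20` (`≤ signVariations < #support ≤ 21`; Mathlib's `roots_countP_pos_le_signVariations` and the
tree's `signVariations_lt_card_support`). [folklore] -/
theorem countP_pos_roots_gramPoly_le (d : Fin 6 → ℕ) (M : Matrix (Fin 6) (Fin 6) ℝ) (hf : gramPoly d M ≠ 0) :
    (gramPoly d M).roots.countP (fun t => 0 < t) ≤ 20 := by
  classical
  have h1 := (gramPoly d M).roots_countP_pos_le_signVariations
  have h2 := Literature.Computability.AlgebraicComplexity.signVariations_lt_card_support hf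
  have h3 : (gramPoly d M).support.card ≤ 21 :=
    (Finset.card_le_card (gramPoly_support_subset d M)).trans (Finset.card_image_le.trans card_pairDom.le)
  omega

/-- The sum of the multiplicities of the twenty prescribed roots is at most the positive-root count with multiplicity. [folklore] -/
theorem sum_rootMultiplicity_le (f : ℝ[X]) (r : Fin 20 → ℝ) (hr : Function.Injective r) (hpos : ∀ a, 0 < r a) :
    ∑ a, f.rootMultiplicity (r a) ≤ f.roots.countP (fun t => 0 < t) := by
  classical
  rw [Multiset.countP_eq_card_filter, ← Multiset.toFinset_sum_count_eq]
  have hcount : ∀ a, f.rootMultiplicity (r a) = (f.roots.filter (fun t => 0 < t)).count (r a) := by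
    intro a
    rw [Multiset.count_filter_of_pos (hpos a), count_roots]
  simp_rw [hcount]
  rw [← Finset.sum_image (f := fun x => (f.roots.filter (fun t => 0 < t)).count x)
    (fun a _ b _ h => hr h)]
  refine Finset.sum_le_sum_of_ne_zero fun x hx hne => ?_
  rw [Multiset.mem_toFinset, ← Multiset.count_ne_zero]
  exact hne

/-- **The roots of a would-be Gram's fewnomial are simple.**  For Sidon data `(E, σ)` of `d`, sorted positive roots `r` and
`c ≠ 0`, each `r_a` is a root of `gramPoly d (extremalGram E σ r c)` of multiplicity exactly `1` (twenty distinct positive roots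
already exhaust Descartes' bound with multiplicity). [folklore] -/
theorem rootMultiplicity_extremalGram_eq_one (d : Fin 6 → ℕ) (E : Fin 21 → ℕ) (σ : Fin 6 → Fin 6 → Fin 21)
    (r : Fin 20 → ℝ) (c : ℝ) (hE : StrictMono E) (hσ : ∀ i j, σ i j = σ j i) (hEσ : ∀ i j, E (σ i j) = d i + d j)
    (hsurj : ∀ k, ∃ i j, σ i j = k) (hr : StrictMono r) (hr0 : 0 < r 0) (hc : c ≠ 0) (a : Fin 20) :
    (gramPoly d (extremalGram E σ r c)).rootMultiplicity (r a) = 1 := by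
  classical
  have hpos : ∀ b, 0 < r b := fun b => lt_of_lt_of_le hr0 (hr.monotone (Fin.zero_le b))
  have hf := gramPoly_extremalGram_ne_zero d E σ r c hE hσ hEσ hsurj hr hr0 hc
  have hge : ∀ b, 1 ≤ (gramPoly d (extremalGram E σ r c)).rootMultiplicity (r b) := fun b =>
    (rootMultiplicity_pos hf).mpr (gramPoly_extremalGram_isRoot d E σ hσ hEσ hsurj r c b)
  have hsum := (sum_rootMultiplicity_le _ r hr.injective hpos).trans (countP_pos_roots_gramPoly_le d _ hf)
  -- twenty multiplicities, each `≥ 1`, summing to `≤ 20`: all equal `1`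
  by_contra hne
  have h2 : 2 ≤ (gramPoly d (extremalGram E σ r c)).rootMultiplicity (r a) := by
    have := hge a
    omega
  have hsplit : ∑ b, (gramPoly d (extremalGram E σ r c)).rootMultiplicity (r b) =
      (gramPoly d (extremalGram E σ r c)).rootMultiplicity (r a) +
        ∑ b ∈ Finset.univ.erase a, (gramPoly d (extremalGram E σ r c)).rootMultiplicity (r b) :=
    (Finset.add_sum_erase _ _ (Finset.mem_univ a)).symm
  have hrest : (Finset.univ.erase a).card ≤
      ∑ b ∈ Finset.univ.erase a, (gramPoly d (extremalGram E σ r c)).rootMultiplicity (r b) := by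
    rw [Finset.card_eq_sum_ones]
    exact Finset.sum_le_sum fun b _ => hge b
  have hcard : (Finset.univ.erase a).card = 19 := by
    rw [Finset.card_erase_of_mem (Finset.mem_univ a), Finset.card_univ, Fintype.card_fin]
  omega

/-! ### 3. Indefiniteness -/

/-- **Every `K = 6` would-be Gram is INDEFINITE: `n₊ ≥ 1` and `n₋ ≥ 1`** (for either sign of `c`).  The quadratic form of
`M = extremalGram E σ r c` along the moment curve is the fewnomial `gramPoly d M`, which has a SIMPLE zero at `r₀`
(`rootMultiplicity_extremalGram_eq_one`), hence a non-vanishing derivative there and a strict sign change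
(`Census.RealExp.exists_sign_change_of_hasDerivAt`): the moment vectors `γ(x)` just left and right of `r₀` have `M`-norms of
opposite signs.  This is rung ONE of the line's conjectured signature law `stub_signatureLaw6` (which asks for `n₊ ≥ 2`, i.e.
`TwoPositive`, and is OPEN); it is the whole law at `K = 4` in the pattern `min(n₊,n₋) ≥ ⌊(K−2)/2⌋` of the line card.  Nothing
here proves `DoorA26` or bears on `MatrixDescartes` / `VP ≠ VNP`. [folklore] -/
theorem indefinite_extremalGram (d : Fin 6 → ℕ) (E : Fin 21 → ℕ) (σ : Fin 6 → Fin 6 → Fin 21) (r : Fin 20 → ℝ) (c : ℝ)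
    (hE : StrictMono E) (hσ : ∀ i j, σ i j = σ j i) (hEσ : ∀ i j, E (σ i j) = d i + d j) (hsurj : ∀ k, ∃ i j, σ i j = k)
    (hr : StrictMono r) (hr0 : 0 < r 0) (hc : c ≠ 0) :
    (∃ x : Fin 6 → ℝ, 0 < x ⬝ᵥ (extremalGram E σ r c).mulVec x) ∧
      (∃ y : Fin 6 → ℝ, y ⬝ᵥ (extremalGram E σ r c).mulVec y < 0) := by
  classical
  set f := gramPoly d (extremalGram E σ r c) with hfdef
  have hf : f ≠ 0 := gramPoly_extremalGram_ne_zero d E σ r c hE hσ hEσ hsurj hr hr0 hc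
  have hroot : f.IsRoot (r 0) := gramPoly_extremalGram_isRoot d E σ hσ hEσ hsurj r c 0
  -- simple root ⇒ the derivative does not vanish
  have hder : ¬ (derivative f).IsRoot (r 0) := by
    intro h
    have h1 : 1 < f.rootMultiplicity (r 0) := (one_lt_rootMultiplicity_iff_isRoot hf).mpr ⟨hroot, h⟩
    have h2 := rootMultiplicity_extremalGram_eq_one d E σ r c hE hσ hEσ hsurj hr hr0 hc 0
    rw [← hfdef] at h2
    omega
  have hD : HasDerivAt (fun x => f.eval x) ((derivative f).eval (r 0)) (r 0) := f.hasDerivAt (r 0)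
  obtain ⟨p, q, -, -, -, -, hpq⟩ := exists_sign_change_of_hasDerivAt hD hroot hder zero_lt_one
  -- one of `f p`, `f q` is positive and the other negative
  rcases mul_neg_iff.mp hpq with ⟨hp, hq⟩ | ⟨hp, hq⟩
  · exact ⟨⟨fun i => p ^ d i, by rw [momentCurve_form_eq_eval]; exact hp⟩,
      ⟨fun i => q ^ d i, by rw [momentCurve_form_eq_eval]; exact hq⟩⟩
  · exact ⟨⟨fun i => q ^ d i, by rw [momentCurve_form_eq_eval]; exact hq⟩,
      ⟨fun i => p ^ d i, by rw [momentCurve_form_eq_eval]; exact hp⟩⟩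

end Summit.ValiantsHypothesis.ValiantsHypothesis.Theorems.LacunarySymmetroid.DoorA26.ExtremalInverse
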